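import Summits.CriticalPhenomena.CardyFormulaZ2.Theorems.CardySelfDualSegmentUniformMarginalityTransportGlue
import Summits.CriticalPhenomena.CardyFormulaZ2.Theorems.CardySelfDualSegmentUniformMarginalitySandwichGlueFixed
import Summits.CriticalPhenomena.CardyFormulaZ2.Theorems.CardySelfDualSegmentUniformMarginalityPairGlue

/-!
# Reduction of the crux `UniformMarginality` to rectilinear domains (line `Sketch`, stmt-CriticalPhenomena-5472)

The sorry-free composition of the lead's skeleton v7 (`Cruxes/UniformMarginality/Lines/Sketch.lean`),
landed as a theorem: **the crux for ARBITRARY conformal rectangles follows from two statements about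
RECTILINEAR conformal rectangles only** —

* (B₁) the crux on rectilinear domains: for `R` with boundary covered by finitely many axis-parallel
  segments, `t ↦ P_t(R,δ)` has at every `t₀ ∈ [0,1]` a modulus of continuity uniform in the mesh
  (quantitative marginality proper; the line's route to it is the δ-uniform Russo bound — exact Russo
  identity (R), large-mesh half and mean-value glue landed);
* (B₂) rectilinear pair continuity at a single parameter: any two rectilinear marked domains
  `ε₀`-close (boundary loop and marks) to the same conformal rectangle have `ε`-close crude
  `M_{t₀}`-crossing probabilities below a mesh threshold (landed at `t₀ = 0` in the `Q`-versus-`R` form,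
  `fixedDomainContinuity_zero`).

`uniformMarginality_of_rectilinearKernels : (B₁) → (B₂) → UniformMarginality`, by the landed chain
`stub_fixedDomainContinuity_of_pair` (p118413) → `stub_uniformSandwichOfFixedDomainContinuity` (p116281)
→ `stub_transportOfUniformSandwich` (p111792) → `uniformMarginality_of_integratedBound` (p96304), which
rests on the geometry `stub_mixedApproximants` (p114647), the nesting `crossEvent_subset_of_mixed`
(p111047), `Pext_mono_of_nested` (p115057) and the large-mesh modulus `integratedBoundAt_of_le_mesh`.
The wild boundary of a conformal rectangle never carries a probability in the hypotheses.
-/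

noncomputable section

namespace Summit.CriticalPhenomena.CardyFormulaZ2.Cruxes.UniformMarginality.HeatFlow

open Literature.Probability.Percolation Literature.Probability.LatticeModels
  Literature.Probability.RandomPlanarGeometry

/-- **The crux reduced to rectilinear domains**: (B₁) the crux on rectilinear conformal rectangles and
(B₂) single-parameter rectilinear pair continuity imply `CardySelfDualSegment.UniformMarginality` for
every conformal rectangle (composition of the landed glue of line `Sketch`, skeleton v7). -/
theorem uniformMarginality_of_rectilinearKernels :
    (∀ R : ConformalRectangle,
      (∃ S : Finset (ℂ × ℂ), (∀ p ∈ S, p.1.re = p.2.re ∨ p.1.im = p.2.im) ∧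
        frontier R.carrier ⊆ ⋃ p ∈ S, segment ℝ p.1 p.2) →
      ∀ t₀ : ℝ, t₀ ∈ Set.Icc (0 : ℝ) 1 → ∀ ε > 0, ∃ η > 0,
        ∀ δ : ℝ, 0 < δ → ∀ t ∈ Set.Icc (0 : ℝ) 1, |t - t₀| < η → |Pext R δ t - Pext R δ t₀| < ε) →
    (∀ (R : ConformalRectangle) (t₀ : ℝ), t₀ ∈ Set.Icc (0 : ℝ) 1 → ∀ ε : ℝ, 0 < ε →
      ∃ ε₀ > 0, ∀ Q₁ Q₂ : ConformalRectangle,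
        (∃ S : Finset (ℂ × ℂ), (∀ p ∈ S, p.1.re = p.2.re ∨ p.1.im = p.2.im) ∧
          frontier Q₁.carrier ⊆ ⋃ p ∈ S, segment ℝ p.1 p.2) →
        (∃ S : Finset (ℂ × ℂ), (∀ p ∈ S, p.1.re = p.2.re ∨ p.1.im = p.2.im) ∧
          frontier Q₂.carrier ⊆ ⋃ p ∈ S, segment ℝ p.1 p.2) →
        (∀ u : ℝ, dist (Q₁.boundary u) (R.boundary u) ≤ ε₀) → (∀ i : Fin 4, |Q₁.mark i - R.mark i| ≤ ε₀) →
        (∀ u : ℝ, dist (Q₂.boundary u) (R.boundary u) ≤ ε₀) → (∀ i : Fin 4, |Q₂.mark i - R.mark i| ≤ ε₀) →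
        ∃ δ₀ > 0, ∀ δ : ℝ, 0 < δ → δ < δ₀ → |Pext Q₁ δ t₀ - Pext Q₂ δ t₀| ≤ ε) →
    Summit.CriticalPhenomena.CardyFormulaZ2.Theses.CardySelfDualSegment.UniformMarginality :=
  fun hB₁ hB₂ => uniformMarginality_of_integratedBound
    (stub_transportOfUniformSandwich
      (stub_uniformSandwichOfFixedDomainContinuity (stub_fixedDomainContinuity_of_pair hB₂) hB₁) hB₁)

end Summit.CriticalPhenomena.CardyFormulaZ2.Cruxes.UniformMarginality.HeatFlow

end
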